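import Mathlib

/-!
# Commutator bootstrapping: from commutators of a generating, conjugation-stable set to all commutators

Helper for stub D₂ `stub_deckUnitaryCommutatorGeneration` of the crux `PowersHodgeOfDeckCommutators`
(stmt-HodgeConjecture-19545, route `CyclicUnitaryPowers`, line `unitary-kunneth-fft` v5, lane 2).  Stub D₁
(`CyclicUnitaryPowersDeckUnitaryCayleyAscent.stub_deckUnitaryCommutatorAscent`) puts in the stabiliser `S` of
the tensor every commutator `[a, b]` of elements of the Cayley-parametrised set `Ω = {γ ∈ U°(ℂ) : det (γ + 1) ≠ 0}`;
this file is the pure group theory that upgrades this to every commutator of `H = U°(ℂ)` once `Ω` is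
conjugation-stable under `H` and `Ω · Ω ⊇ H`:

* `conj_commutator` — `x [a, b] x⁻¹ = [x a x⁻¹, x b x⁻¹]`;
* `commutator_mul_left` — `[a b, c] = (a [b, c] a⁻¹) [a, c]`, `commutator_mul_right` — `[g, a b] = [g, a] (a [g, b] a⁻¹)`;
* `commutator_mem_of_mem_of_mem_cover` — `[g, c] ∈ S` for `g ∈ H`, `c ∈ Ω`;
* `commutator_mem_of_mul_cover` — `[g, h] ∈ S` for all `g, h ∈ H`.
-/

namespace Summit.HodgeConjecture.HodgeConjecture.Theorems.CyclicUnitaryPowersCommutatorBootstrap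

variable {G : Type*} [Group G]

/-- Conjugate of a commutator: `x (a b a⁻¹ b⁻¹) x⁻¹ = [x a x⁻¹, x b x⁻¹]`. [folklore] -/
theorem conj_commutator (x a b : G) :
    x * (a * b * a⁻¹ * b⁻¹) * x⁻¹ =
      (x * a * x⁻¹) * (x * b * x⁻¹) * (x * a * x⁻¹)⁻¹ * (x * b * x⁻¹)⁻¹ := by
  group

/-- `[a b, c] = (a [b, c] a⁻¹) · [a, c]`. [folklore] -/
theorem commutator_mul_left (a b c : G) :
    a * b * c * (a * b)⁻¹ * c⁻¹ = (a * (b * c * b⁻¹ * c⁻¹) * a⁻¹) * (a * c * a⁻¹ * c⁻¹) := by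
  group

/-- `[g, a b] = [g, a] · (a [g, b] a⁻¹)`. [folklore] -/
theorem commutator_mul_right (g a b : G) :
    g * (a * b) * g⁻¹ * (a * b)⁻¹ = (g * a * g⁻¹ * a⁻¹) * (a * (g * b * g⁻¹ * b⁻¹) * a⁻¹) := by
  group

/-- If `S` contains the commutators of elements of `Ω`, `Ω ⊆ H` is stable under conjugation by `H`, and every
element of `H` is a product of two elements of `Ω`, then `[g, c] ∈ S` for `g ∈ H`, `c ∈ Ω`. [folklore] -/
theorem commutator_mem_of_mem_of_mem_cover (S H : Subgroup G) (Ω : Set G) (hΩ : Ω ⊆ H)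
    (hconj : ∀ h ∈ H, ∀ a ∈ Ω, h * a * h⁻¹ ∈ Ω) (hcover : ∀ h ∈ H, ∃ a ∈ Ω, ∃ b ∈ Ω, h = a * b)
    (hS : ∀ a ∈ Ω, ∀ b ∈ Ω, a * b * a⁻¹ * b⁻¹ ∈ S) {g c : G} (hg : g ∈ H) (hc : c ∈ Ω) :
    g * c * g⁻¹ * c⁻¹ ∈ S := by
  obtain ⟨a, ha, b, hb, rfl⟩ := hcover g hg
  rw [commutator_mul_left, conj_commutator]
  exact S.mul_mem (hS _ (hconj a (hΩ ha) b hb) _ (hconj a (hΩ ha) c hc)) (hS a ha c hc)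

/-- **Commutator bootstrapping.** If `S` contains the commutators of elements of `Ω`, `Ω ⊆ H` is stable under
conjugation by `H`, and `Ω · Ω ⊇ H`, then `S` contains every commutator of elements of `H`. [folklore] -/
theorem commutator_mem_of_mul_cover (S H : Subgroup G) (Ω : Set G) (hΩ : Ω ⊆ H)
    (hconj : ∀ h ∈ H, ∀ a ∈ Ω, h * a * h⁻¹ ∈ Ω) (hcover : ∀ h ∈ H, ∃ a ∈ Ω, ∃ b ∈ Ω, h = a * b)
    (hS : ∀ a ∈ Ω, ∀ b ∈ Ω, a * b * a⁻¹ * b⁻¹ ∈ S) {g h : G} (hg : g ∈ H) (hh : h ∈ H) :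
    g * h * g⁻¹ * h⁻¹ ∈ S := by
  obtain ⟨a, ha, b, hb, rfl⟩ := hcover h hh
  rw [commutator_mul_right, conj_commutator]
  refine S.mul_mem (commutator_mem_of_mem_of_mem_cover S H Ω hΩ hconj hcover hS hg ha) ?_
  exact commutator_mem_of_mem_of_mem_cover S H Ω hΩ hconj hcover hS
    (H.mul_mem (H.mul_mem (hΩ ha) hg) (H.inv_mem (hΩ ha))) (hconj a (hΩ ha) b hb)

end Summit.HodgeConjecture.HodgeConjecture.Theorems.CyclicUnitaryPowersCommutatorBootstrap
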